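import Literature.MathematicalPhysics.QuantumLattice.LatticeGaugeDLRGibbsProofs
import Literature.RepresentationTheory.CompactGroups.UnitaryTrick
import HarnessLib

/-!
# Lattice symmetries of the lattice Yang–Mills specification: translations and coordinate
# permutations act on the DLR kernels and on the set of Gibbs states

Sibling proof file of `Literature/MathematicalPhysics/QuantumLattice/LatticeGaugeDLR.lean` (same
namespace), next to `LatticeGaugeDLRProofs.lean` (gauge covariance
`ymSpecification_map_gaugeTransformZd_holds`). It proves the covariance of the Wilson specification
`γ_Λ(· | η) = ymSpecification ρ β Λ η` under the **lattice symmetries** that relabel the positively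
oriented edges of `ℤ^d` — translations `x ↦ x + v` and coordinate permutations `x ↦ x ∘ σ⁻¹` — and
the resulting invariance of the set `𝒢(β) = ymGibbsMeasures ρ β` of DLR states (Georgii 2011, §5.1
«transformations of specifications», (5.3)–(5.8): a transformation `τ` of the configuration space
with `τ(γ) = γ` maps `𝒢(γ)` onto itself; Seiler LNP 159 Ch. 2: the Wilson action is invariant under
the symmetries of the hypercubic lattice). No named fact is introduced; every statement is proved.

* `relabelConfig φ` — the measurable automorphism `U ↦ U ∘ φ⁻¹` of `LGConfig d G = (edges → G)`
  induced by a bijection `φ` of the edge set (Mathlib `MeasurableEquiv.arrowCongr'`); the tree's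
  `configShift v` is `relabelConfig (edgeShift v)` (`configShift_eq_relabelConfig`, `rfl`).
* `tilted_comp_map` — change of variables for Mathlib's `Measure.tilted`:
  `(μ.tilted (g ∘ Ψ)).map Ψ = (μ.map Ψ).tilted g`.
* `ymSpecification_map_relabelConfig` — **covariance of the kernels**: if the boundary Wilson
  action is `φ`-invariant, `S_{φΛ}(U ∘ φ⁻¹) = S_Λ(U)` for all finite `Λ` and all `U`, then
  `γ_Λ(· | η) ∘ (relabelConfig φ)⁻¹ = γ_{φΛ}(· | η ∘ φ⁻¹)` (Georgii 2011, (5.6)–(5.8));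
  `isGibbsMeasure_map_relabelConfig` / `map_relabelConfig_mem_ymGibbsMeasures` — the push-forward of
  a DLR state under such a symmetry is a DLR state (Georgii 2011, Remark (5.10)).
* Translations: `plaquetteShift`, `plaquetteEdges_plaquetteShift`,
  `plaquettesTouching_map_edgeShift`, `plaquetteHolonomyZd_configShift_add`,
  `wilsonBoundaryAction_configShift` (`S_{Λ+v}(θ_v U) = S_Λ(U)`), `ymSpecification_map_configShift`,
  `map_configShift_mem_ymGibbsMeasures` (Seiler LNP 159 Ch. 2; Georgii 2011, (5.3)–(5.4)).
* Coordinate permutations `σ ∈ Sym(Fin d)`: `sitePerm σ` (`x ↦ x ∘ σ⁻¹`), `edgePerm σ`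
  (`(x, i) ↦ (x ∘ σ⁻¹, σ i)`), `plaquettePerm σ` (the plane `{i, j}` goes to `{σ i, σ j}`,
  re-ordered), `plaquetteEdges_plaquettePerm`, `plaquettesTouching_map_edgePerm`,
  `plaquetteHolonomyZd_relabel_edgePerm`, `plaquetteHolonomyZd_swap` (`U_{x;ji} = U_{x;ij}⁻¹`),
  `wilsonBoundaryAction_relabel_edgePerm` (uses `Re tr ρ(g⁻¹) = Re tr ρ(g)` for a continuous
  representation of a compact group, `CompactGroup.re_trace_map_inv`),
  `ymSpecification_map_relabel_edgePerm`, `map_relabel_edgePerm_mem_ymGibbsMeasures`.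

These are used by `CentreSymmetryConfinementProofs.lean` (Chatterjee 2021, Thm. 2.2: the slab of
the centre-symmetry hypothesis is pinned to the coordinate direction `0` and to the base height `0`,
while the conclusion is about rectangular loops in every plane and at every base point).

## References

* H.-O. Georgii, *Gibbs Measures and Phase Transitions*, 2nd ed. (de Gruyter 2011), §5.1,
  (5.3)–(5.10) (transformations of configurations, specifications and Gibbs measures).
* E. Seiler, *Gauge Theories as a Problem of Constructive Quantum Field Theory and Statistical
  Mechanics*, LNP 159 (Springer 1982), Ch. 2 (symmetries of the Wilson action).
-/

noncomputable section

open MeasureTheory Finset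
open Literature.Probability.LatticeModels

namespace Literature.MathematicalPhysics.QuantumLattice

variable {d N : ℕ} {G : Type*}

/-! ### A change-of-variables lemma for `Measure.tilted` -/

/-- Tilting commutes with push-forward: tilting `μ` by `g ∘ Ψ` and pushing forward along `Ψ` is
tilting `Ψ_* μ` by `g` (change of variables in the density and in its normalisation). [folklore] -/
private theorem tilted_comp_map {α γ : Type*} [MeasurableSpace α] [MeasurableSpace γ] (μ : Measure α)
    {Ψ : α → γ} (hΨ : Measurable Ψ) {g : γ → ℝ} (hg : Measurable g) :
    (μ.tilted (g ∘ Ψ)).map Ψ = (μ.map Ψ).tilted g := by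
  have hexp : Measurable fun y => Real.exp (g y) := Real.measurable_exp.comp hg
  have hC : ∫ y, Real.exp (g y) ∂(μ.map Ψ) = ∫ x, Real.exp ((g ∘ Ψ) x) ∂μ := by
    rw [integral_map hΨ.aemeasurable hexp.aestronglyMeasurable]; rfl
  ext s hs
  have hdens : Measurable fun y =>
      ENNReal.ofReal (Real.exp (g y) / ∫ x, Real.exp (g x) ∂(μ.map Ψ)) :=
    ENNReal.measurable_ofReal.comp (hexp.div_const _)
  rw [Measure.map_apply hΨ hs, Measure.tilted, Measure.tilted, withDensity_apply _ (hΨ hs),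
    withDensity_apply _ hs, setLIntegral_map hs hdens hΨ, hC]
  rfl

/-! ### Relabelling configurations along a bijection of the edge set -/

section Relabel

variable [MeasurableSpace G]

/-- The configuration relabelled along a bijection `φ` of the edges of `ℤ^d`:
`(relabelConfig φ U) e = U (φ⁻¹ e)`, as a measurable automorphism of `LGConfig d G`
(Mathlib `MeasurableEquiv.arrowCongr'`; Georgii 2011 (5.3) for translations). [cite: Georgii2011, §5.1 (5.3)] -/
def relabelConfig (φ : ZdEdge d ≃ ZdEdge d) : LGConfig d G ≃ᵐ LGConfig d G :=
  MeasurableEquiv.arrowCongr' φ (MeasurableEquiv.refl G)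

/-- `relabelConfig φ U e = U (φ⁻¹ e)`. [cite: Georgii2011, §5.1 (5.3)] -/
@[simp] theorem relabelConfig_apply (φ : ZdEdge d ≃ ZdEdge d) (U : LGConfig d G) (e : ZdEdge d) :
    relabelConfig φ U e = U (φ.symm e) := rfl

/-- The inverse relabelling is relabelling along `φ⁻¹`. [cite: Georgii2011, §5.1 (5.3)] -/
@[simp] theorem relabelConfig_symm_apply (φ : ZdEdge d ≃ ZdEdge d) (U : LGConfig d G)
    (e : ZdEdge d) : (relabelConfig φ).symm U e = U (φ e) := rfl

/-- The tree's translation `configShift v` is the relabelling along `edgeShift v`. [cite: Georgii2011, §5.1 (5.3)] -/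
theorem configShift_eq_relabelConfig (v : Site d) :
    configShift (G := G) v = relabelConfig (edgeShift v) := rfl

/-- The bijection `Λ ≃ φ(Λ)` of finite edge sets induced by `φ`. [folklore] -/
def finsetRelabel (φ : ZdEdge d ≃ ZdEdge d) (Λ : Finset (ZdEdge d)) :
    ↥Λ ≃ ↥(Λ.map φ.toEmbedding) :=
  φ.subtypeEquiv fun _ => (Finset.mem_map' φ.toEmbedding).symm

/-- `finsetRelabel φ Λ e = φ e`. [folklore] -/
@[simp] private theorem coe_finsetRelabel_apply (φ : ZdEdge d ≃ ZdEdge d) (Λ : Finset (ZdEdge d)) (e : ↥Λ) :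
    ((finsetRelabel φ Λ e : ↥(Λ.map φ.toEmbedding)) : ZdEdge d) = φ e := rfl

/-- `(finsetRelabel φ Λ)⁻¹ e' = φ⁻¹ e'`. [folklore] -/
@[simp] private theorem coe_finsetRelabel_symm_apply (φ : ZdEdge d ≃ ZdEdge d) (Λ : Finset (ZdEdge d))
    (e' : ↥(Λ.map φ.toEmbedding)) : (((finsetRelabel φ Λ).symm e' : ↥Λ) : ZdEdge d) = φ.symm e' :=
  rfl

/-- Transport of finite configurations `G^Λ → G^{φΛ}` along `φ` (Mathlib `piCongrLeft` for the
constant family): `ζ ↦ ζ ∘ (finsetRelabel φ Λ)⁻¹`. [folklore] -/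
private theorem piCongrLeft_const_apply {ι ι' S : Type*} [MeasurableSpace S] (e : ι ≃ ι') (f : ι → S)
    (b : ι') : MeasurableEquiv.piCongrLeft (fun _ => S) e f b = f (e.symm b) := by
  rw [MeasurableEquiv.coe_piCongrLeft, Equiv.piCongrLeft_apply_eq_cast, cast_eq]

/-- Relabelling intertwines the gluing maps: `(ζ η_{Λᶜ}) ∘ φ⁻¹ = (ζ ∘ φ⁻¹) (η ∘ φ⁻¹)_{(φΛ)ᶜ}`. [cite: Georgii2011, §5.1 (5.6)] -/
theorem relabelConfig_comp_glueWith (φ : ZdEdge d ≃ ZdEdge d) (Λ : Finset (ZdEdge d))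
    (η : LGConfig d G) :
    (relabelConfig φ ∘ fun ζ : ↥Λ → G => glueWith Λ ζ η) =
      (fun ζ' : ↥(Λ.map φ.toEmbedding) → G => glueWith (Λ.map φ.toEmbedding) ζ' (relabelConfig φ η)) ∘
        MeasurableEquiv.piCongrLeft (fun _ => G) (finsetRelabel φ Λ) := by
  funext ζ
  funext e'
  simp only [Function.comp_apply, relabelConfig_apply]
  by_cases h : φ.symm e' ∈ Λ
  · have h' : e' ∈ Λ.map φ.toEmbedding := Finset.mem_map_equiv.2 h
    rw [glueWith_apply_mem _ _ _ h, glueWith_apply_mem _ _ _ h', piCongrLeft_const_apply]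
    congr 1
  · have h' : e' ∉ Λ.map φ.toEmbedding := fun h' => h (Finset.mem_map_equiv.1 h')
    rw [glueWith_apply_not_mem _ _ _ h, glueWith_apply_not_mem _ _ _ h', relabelConfig_apply]

/-- `φ⁻¹(φ(Λ)) = Λ` for finite edge sets. [folklore] -/
private theorem map_symm_map_toEmbedding (φ : ZdEdge d ≃ ZdEdge d) (Λ : Finset (ZdEdge d)) :
    (Λ.map φ.symm.toEmbedding).map φ.toEmbedding = Λ := by
  ext e
  rw [Finset.mem_map_equiv, Finset.mem_map_equiv, Equiv.symm_symm, Equiv.apply_symm_apply]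

end Relabel

/-! ### Covariance of the Wilson specification under action-preserving relabellings -/

section Covariance

variable [Group G] [TopologicalSpace G] [IsTopologicalGroup G] [CompactSpace G] [MeasurableSpace G]
  [BorelSpace G] [SecondCountableTopology G] (ρ : G →* Matrix (Fin N) (Fin N) ℂ)

/-- **Covariance of the lattice Yang–Mills kernels under a lattice symmetry** (Georgii 2011, §5.1
(5.6)–(5.8): `τ(γ_Λ)(· | τ η) = τ_* γ_{τ⁻¹Λ}(· | η)`): if a bijection `φ` of the edges of `ℤ^d`
preserves the boundary Wilson action, `S_{φΛ}(U ∘ φ⁻¹) = S_Λ(U)`, then for continuous `ρ` and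
second-countable compact `G` the push-forward of the kernel `γ_Λ(· | η)` under `U ↦ U ∘ φ⁻¹` is the
kernel `γ_{φΛ}(· | η ∘ φ⁻¹)`. Proof: tilting commutes with the push-forward (`tilted_comp_map`, the
tilt `exp(−β S_Λ)` being the pull-back of `exp(−β S_{φΛ})`), relabelling intertwines the gluing maps
(`relabelConfig_comp_glueWith`), and the product Haar measure on `G^Λ` is transported to the product
Haar measure on `G^{φΛ}` (Mathlib `measurePreserving_piCongrLeft`). [cite: Georgii2011, §5.1 (5.6)–(5.8)] -/
theorem ymSpecification_map_relabelConfig (hρ : Continuous ρ) (β : ℝ) (φ : ZdEdge d ≃ ZdEdge d)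
    (hφ : ∀ (Λ : Finset (ZdEdge d)) (U : LGConfig d G),
      wilsonBoundaryAction ρ (Λ.map φ.toEmbedding) (relabelConfig φ U) = wilsonBoundaryAction ρ Λ U)
    (Λ : Finset (ZdEdge d)) (η : LGConfig d G) :
    (ymSpecification ρ β Λ η).map (relabelConfig φ) =
      ymSpecification ρ β (Λ.map φ.toEmbedding) (relabelConfig φ η) := by
  have hΨ : Measurable (relabelConfig (G := G) φ) := (relabelConfig φ).measurable
  have hg : Measurable fun U : LGConfig d G =>
      -β * wilsonBoundaryAction ρ (Λ.map φ.toEmbedding) U :=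
    (continuous_const.mul (continuous_wilsonBoundaryAction ρ hρ _)).measurable
  have hcomp : (fun U : LGConfig d G => -β * wilsonBoundaryAction ρ Λ U) =
      (fun U : LGConfig d G => -β * wilsonBoundaryAction ρ (Λ.map φ.toEmbedding) U) ∘
        relabelConfig φ := by
    funext U
    rw [Function.comp_apply, hφ]
  haveI : IsFiniteMeasure (QuantumFieldTheory.haarProbability G) := by
    unfold QuantumFieldTheory.haarProbability; infer_instance
  unfold ymSpecification
  rw [hcomp, tilted_comp_map _ hΨ hg, Measure.map_map hΨ (measurable_glueWith Λ η),
    relabelConfig_comp_glueWith φ Λ η,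
    ← Measure.map_map (measurable_glueWith _ (relabelConfig φ η)) (MeasurableEquiv.measurable _),
    (measurePreserving_piCongrLeft (fun _ : ↥(Λ.map φ.toEmbedding) =>
      QuantumFieldTheory.haarProbability G) (finsetRelabel φ Λ)).map_eq]

/-- **A lattice symmetry of the specification maps DLR states to DLR states** (Georgii 2011, §5.1,
Remark (5.10): `τ(𝒢(γ)) = 𝒢(τ(γ))`, here with `τ(γ) = γ`): under the hypothesis of
`ymSpecification_map_relabelConfig`, if `μ` satisfies the DLR equations for `ymSpecification ρ β`
then so does `μ ∘ (relabelConfig φ)⁻¹`. [cite: Georgii2011, §5.1 Remark (5.10)] -/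
theorem isGibbsMeasure_map_relabelConfig (hρ : Continuous ρ) (β : ℝ) (φ : ZdEdge d ≃ ZdEdge d)
    (hφ : ∀ (Λ : Finset (ZdEdge d)) (U : LGConfig d G),
      wilsonBoundaryAction ρ (Λ.map φ.toEmbedding) (relabelConfig φ U) = wilsonBoundaryAction ρ Λ U)
    {μ : Measure (LGConfig d G)} (hμ : IsGibbsMeasure (ymSpecification ρ β) μ) :
    IsGibbsMeasure (ymSpecification ρ β) (μ.map (relabelConfig φ)) := by
  have hΨ : Measurable (relabelConfig (G := G) φ) := (relabelConfig φ).measurable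
  haveI := hμ.1
  refine ⟨Measure.isProbabilityMeasure_map hΨ.aemeasurable, fun Λ A hA => ?_⟩
  have h1 : ∫⁻ η, ymSpecification ρ β Λ η A ∂μ.map (relabelConfig φ) =
      ∫⁻ η, ymSpecification ρ β Λ (relabelConfig φ η) A ∂μ :=
    lintegral_map_equiv _ _
  have h2 : ∀ η, ymSpecification ρ β Λ (relabelConfig φ η) A =
      ymSpecification ρ β (Λ.map φ.symm.toEmbedding) η (relabelConfig φ ⁻¹' A) := fun η => by
    conv_lhs => rw [← map_symm_map_toEmbedding φ Λ]
    rw [← ymSpecification_map_relabelConfig ρ hρ β φ hφ, Measure.map_apply hΨ hA]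
  rw [h1]
  simp_rw [h2]
  rw [hμ.2 _ _ (hΨ hA), Measure.map_apply hΨ hA]

/-- The set `𝒢(β)` of lattice Yang–Mills DLR states is invariant under every action-preserving
relabelling of the edges (Georgii 2011, §5.1 Remark (5.10)). [cite: Georgii2011, §5.1 Remark (5.10)] -/
theorem map_relabelConfig_mem_ymGibbsMeasures (hρ : Continuous ρ) (β : ℝ) (φ : ZdEdge d ≃ ZdEdge d)
    (hφ : ∀ (Λ : Finset (ZdEdge d)) (U : LGConfig d G),
      wilsonBoundaryAction ρ (Λ.map φ.toEmbedding) (relabelConfig φ U) = wilsonBoundaryAction ρ Λ U)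
    {μ : Measure (LGConfig d G)} (hμ : μ ∈ ymGibbsMeasures ρ β) :
    μ.map (relabelConfig φ) ∈ ymGibbsMeasures ρ β :=
  isGibbsMeasure_map_relabelConfig ρ hρ β φ hφ hμ

end Covariance

/-! ### Translations -/

section Translation

/-- Translation of plaquettes by `v ∈ ℤ^d` (base point `x ↦ x + v`, same plane). [cite: Georgii2011, §5.1 (5.3)] -/
def plaquetteShift (v : Site d) : ZdPlaquette d ≃ ZdPlaquette d :=
  (Site.shift v).prodCongr (Equiv.refl _)

/-- `plaquetteShift v (x, ij) = (x + v, ij)`. [cite: Georgii2011, §5.1 (5.3)] -/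
@[simp] theorem plaquetteShift_apply (v : Site d) (p : ZdPlaquette d) :
    plaquetteShift v p = (p.1 + v, p.2) := rfl

/-- The edges of a translated plaquette are the translated edges (bookkeeping for the shift-invariance of the Wilson interaction). [cite: Georgii2011, §5.1 (5.7)] -/
theorem plaquetteEdges_plaquetteShift (v : Site d) (p : ZdPlaquette d) :
    plaquetteEdges (plaquetteShift v p) = (plaquetteEdges p).map (edgeShift v).toEmbedding := by
  simp only [plaquetteEdges, plaquetteShift_apply, Finset.map_insert, Finset.map_singleton,
    Equiv.toEmbedding_apply, edgeShift_apply, add_right_comm _ v]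

/-- The plaquettes touching a translated edge set are the translated plaquettes (bookkeeping for the shift-invariance of the Wilson interaction). [cite: Georgii2011, §5.1 (5.7)] -/
theorem plaquettesTouching_map_edgeShift (v : Site d) (Λ : Finset (ZdEdge d)) :
    plaquettesTouching (Λ.map (edgeShift v).toEmbedding) =
      (plaquettesTouching Λ).map (plaquetteShift v).toEmbedding := by
  ext p
  rw [Finset.mem_map_equiv, mem_plaquettesTouching_iff, mem_plaquettesTouching_iff]
  conv_lhs => rw [← (plaquetteShift v).apply_symm_apply p, plaquetteEdges_plaquetteShift,
    ← Finset.map_inter, Finset.map_nonempty]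

variable [Group G]

/-- The plaquette holonomy of a translated configuration around the translated plaquette is the
original plaquette holonomy: `(θ_v U)_{x+v; ij} = U_{x; ij}`. [cite: Georgii2011, §5.1 (5.3)] -/
theorem plaquetteHolonomyZd_configShift_add [MeasurableSpace G] (v : Site d) (U : LGConfig d G)
    (x : Site d) (i j : Fin d) :
    plaquetteHolonomyZd (configShift v U) (x + v) i j = plaquetteHolonomyZd U x i j := by
  simp only [plaquetteHolonomyZd, configShift_apply, add_right_comm _ v, add_sub_cancel_right]

variable (ρ : G →* Matrix (Fin N) (Fin N) ℂ)

/-- **The boundary Wilson action is translation invariant**: `S_{Λ+v}(θ_v U) = S_Λ(U)`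
(Seiler LNP 159 Ch. 2; Georgii 2011 (5.7), shift-invariant potentials). [cite: Georgii2011, §5.1 (5.7)] -/
theorem wilsonBoundaryAction_configShift [MeasurableSpace G] (v : Site d) (Λ : Finset (ZdEdge d))
    (U : LGConfig d G) :
    wilsonBoundaryAction ρ (Λ.map (edgeShift v).toEmbedding) (configShift v U) =
      wilsonBoundaryAction ρ Λ U := by
  unfold wilsonBoundaryAction
  rw [plaquettesTouching_map_edgeShift, Finset.sum_map]
  refine Finset.sum_congr rfl fun p _ => ?_
  simp only [Equiv.toEmbedding_apply, plaquetteShift_apply, plaquetteObs,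
    plaquetteHolonomyZd_configShift_add]

variable [TopologicalSpace G] [IsTopologicalGroup G] [CompactSpace G] [MeasurableSpace G]
  [BorelSpace G] [SecondCountableTopology G]

/-- **Translation covariance of the lattice Yang–Mills kernels**:
`θ_v γ_Λ(· | η) = γ_{Λ+v}(· | θ_v η)` (Georgii 2011, §5.1 (5.8); Seiler LNP 159 Ch. 2). [cite: Georgii2011, §5.1 (5.8)] -/
theorem ymSpecification_map_configShift (hρ : Continuous ρ) (β : ℝ) (v : Site d)
    (Λ : Finset (ZdEdge d)) (η : LGConfig d G) :
    (ymSpecification ρ β Λ η).map (configShift v) =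
      ymSpecification ρ β (Λ.map (edgeShift v).toEmbedding) (configShift v η) := by
  rw [configShift_eq_relabelConfig]
  exact ymSpecification_map_relabelConfig ρ hρ β (edgeShift v)
    (fun Λ U => wilsonBoundaryAction_configShift ρ v Λ U) Λ η

/-- **Translations act on the lattice Yang–Mills DLR states**: `θ_v μ ∈ 𝒢(β)` for `μ ∈ 𝒢(β)`
(Georgii 2011, §5.1 Remark (5.10); Seiler LNP 159 Ch. 2). [cite: Georgii2011, §5.1 Remark (5.10)] -/
theorem map_configShift_mem_ymGibbsMeasures (hρ : Continuous ρ) (β : ℝ) (v : Site d)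
    {μ : Measure (LGConfig d G)} (hμ : μ ∈ ymGibbsMeasures ρ β) :
    μ.map (configShift v) ∈ ymGibbsMeasures ρ β := by
  rw [configShift_eq_relabelConfig]
  exact map_relabelConfig_mem_ymGibbsMeasures ρ hρ β (edgeShift v)
    (fun Λ U => wilsonBoundaryAction_configShift ρ v Λ U) hμ

end Translation

/-! ### Coordinate permutations -/

section Permutation

/-- A coordinate permutation `σ` acting on sites, `x ↦ x ∘ σ⁻¹` (so that the `i`-th coordinate of
`x` becomes the `σ i`-th coordinate of the image). [cite: SeilerLNP1982, Ch. 2 (hypercubic symmetry of the Wilson action)] -/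
def sitePerm (σ : Equiv.Perm (Fin d)) : Site d ≃ Site d :=
  Equiv.arrowCongr σ (Equiv.refl ℤ)

/-- `sitePerm σ x k = x (σ⁻¹ k)`. [cite: SeilerLNP1982, Ch. 2 (hypercubic symmetry of the Wilson action)] -/
@[simp] theorem sitePerm_apply (σ : Equiv.Perm (Fin d)) (x : Site d) (k : Fin d) :
    sitePerm σ x k = x (σ.symm k) := rfl

/-- `(sitePerm σ)⁻¹ = sitePerm σ⁻¹`. [cite: SeilerLNP1982, Ch. 2 (hypercubic symmetry of the Wilson action)] -/
theorem sitePerm_symm (σ : Equiv.Perm (Fin d)) : (sitePerm σ).symm = sitePerm σ.symm := rfl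

/-- `sitePerm σ` is additive. [cite: SeilerLNP1982, Ch. 2 (hypercubic symmetry of the Wilson action)] -/
theorem sitePerm_add (σ : Equiv.Perm (Fin d)) (x y : Site d) :
    sitePerm σ (x + y) = sitePerm σ x + sitePerm σ y := rfl

/-- `sitePerm σ eᵢ = e_{σ i}` for the unit coordinate vectors. [cite: SeilerLNP1982, Ch. 2 (hypercubic symmetry of the Wilson action)] -/
theorem sitePerm_single (σ : Equiv.Perm (Fin d)) (i : Fin d) (c : ℤ) :
    sitePerm σ (Pi.single i c) = Pi.single (σ i) c := by
  funext k
  rw [sitePerm_apply]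
  by_cases h : k = σ i
  · subst h; simp
  · have h' : σ.symm k ≠ i := fun h' => h (by rw [← h', Equiv.apply_symm_apply])
    rw [Pi.single_eq_of_ne h', Pi.single_eq_of_ne h]

/-- A coordinate permutation acting on positively oriented edges: `(x, i) ↦ (x ∘ σ⁻¹, σ i)` (the
edge from `x` to `x + eᵢ` goes to the edge from `x ∘ σ⁻¹` to `x ∘ σ⁻¹ + e_{σ i}`). [cite: SeilerLNP1982, Ch. 2 (hypercubic symmetry of the Wilson action)] -/
def edgePerm (σ : Equiv.Perm (Fin d)) : ZdEdge d ≃ ZdEdge d :=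
  (sitePerm σ).prodCongr σ

/-- `edgePerm σ (x, i) = (sitePerm σ x, σ i)`. [cite: SeilerLNP1982, Ch. 2 (hypercubic symmetry of the Wilson action)] -/
@[simp] theorem edgePerm_apply (σ : Equiv.Perm (Fin d)) (e : ZdEdge d) :
    edgePerm σ e = (sitePerm σ e.1, σ e.2) := rfl

/-- `(edgePerm σ)⁻¹ (y, k) = (sitePerm σ⁻¹ y, σ⁻¹ k)`. [cite: SeilerLNP1982, Ch. 2 (hypercubic symmetry of the Wilson action)] -/
@[simp] theorem edgePerm_symm_apply (σ : Equiv.Perm (Fin d)) (e : ZdEdge d) :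
    (edgePerm σ).symm e = (sitePerm σ.symm e.1, σ.symm e.2) := rfl

/-- The ordered pair of two distinct coordinate directions. [folklore] -/
def orderedPair (a b : Fin d) (h : a ≠ b) : {p : Fin d × Fin d // p.1 < p.2} :=
  if hab : a < b then ⟨(a, b), hab⟩ else ⟨(b, a), lt_of_le_of_ne (not_lt.1 hab) h.symm⟩

/-- `orderedPair a b = (a, b)` when `a < b`. [folklore] -/
private theorem orderedPair_of_lt {a b : Fin d} (hab : a < b) (h : a ≠ b) :
    orderedPair a b h = ⟨(a, b), hab⟩ := by
  simp [orderedPair, hab]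

/-- `orderedPair a b = (b, a)` when `b < a`. [folklore] -/
private theorem orderedPair_of_gt {a b : Fin d} (hba : b < a) (h : a ≠ b) :
    orderedPair a b h = ⟨(b, a), hba⟩ := by
  simp [orderedPair, not_lt.2 hba.le]

/-- The ordered pair does not depend on the order of its arguments. [folklore] -/
private theorem orderedPair_comm (a b : Fin d) (h : a ≠ b) : orderedPair a b h = orderedPair b a h.symm := by
  rcases lt_or_gt_of_ne h with hab | hba
  · rw [orderedPair_of_lt hab, orderedPair_of_gt hab]
  · rw [orderedPair_of_gt hba, orderedPair_of_lt hba]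

/-- A coordinate permutation acting on plaquettes (as a function): base point `x ↦ x ∘ σ⁻¹`, plane
`{i, j} ↦ {σ i, σ j}` (re-ordered increasingly). [cite: SeilerLNP1982, Ch. 2 (hypercubic symmetry of the Wilson action)] -/
def plaquettePermFun (σ : Equiv.Perm (Fin d)) (p : ZdPlaquette d) : ZdPlaquette d :=
  (sitePerm σ p.1, orderedPair (σ p.2.1.1) (σ p.2.1.2) (σ.injective.ne (ne_of_lt p.2.2)))

/-- The underlying pair of `orderedPair a b`. [folklore] -/
private theorem orderedPair_val (a b : Fin d) (h : a ≠ b) :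
    (orderedPair a b h).1 = if a < b then (a, b) else (b, a) := by
  unfold orderedPair
  split_ifs <;> rfl

/-- The base point of the permuted plaquette. [folklore] -/
@[simp] private theorem plaquettePermFun_fst (σ : Equiv.Perm (Fin d)) (p : ZdPlaquette d) :
    (plaquettePermFun σ p).1 = sitePerm σ p.1 := rfl

/-- The (ordered) pair of directions of the permuted plaquette. [folklore] -/
private theorem plaquettePermFun_snd_val (σ : Equiv.Perm (Fin d)) (p : ZdPlaquette d) :
    (plaquettePermFun σ p).2.1 =
      if σ p.2.1.1 < σ p.2.1.2 then (σ p.2.1.1, σ p.2.1.2) else (σ p.2.1.2, σ p.2.1.1) := by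
  simp only [plaquettePermFun, orderedPair_val]

/-- `plaquettePermFun σ⁻¹` inverts `plaquettePermFun σ`. [folklore] -/
private theorem plaquettePermFun_symm_apply (σ : Equiv.Perm (Fin d)) (p : ZdPlaquette d) :
    plaquettePermFun σ.symm (plaquettePermFun σ p) = p := by
  obtain ⟨x, ⟨⟨i, j⟩, hij⟩⟩ := p
  have hij' : i < j := hij
  have hne : σ i ≠ σ j := σ.injective.ne (ne_of_lt hij')
  refine Prod.ext ?_ (Subtype.ext ?_)
  · rw [plaquettePermFun_fst, plaquettePermFun_fst, ← sitePerm_symm, Equiv.symm_apply_apply]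
  · rw [plaquettePermFun_snd_val, plaquettePermFun_snd_val]
    rcases lt_or_gt_of_ne hne with h | h
    · simp only [if_pos h, Equiv.symm_apply_apply, if_pos hij']
    · simp only [if_neg (not_lt.2 h.le), Equiv.symm_apply_apply, if_neg (not_lt.2 hij'.le)]

/-- A coordinate permutation acting on plaquettes, as a bijection. [cite: SeilerLNP1982, Ch. 2 (hypercubic symmetry of the Wilson action)] -/
def plaquettePerm (σ : Equiv.Perm (Fin d)) : ZdPlaquette d ≃ ZdPlaquette d where
  toFun := plaquettePermFun σ
  invFun := plaquettePermFun σ.symm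
  left_inv p := plaquettePermFun_symm_apply σ p
  right_inv p := by simpa only [Equiv.symm_symm] using plaquettePermFun_symm_apply σ.symm p

/-- `plaquettePerm σ p = plaquettePermFun σ p`. [cite: SeilerLNP1982, Ch. 2 (hypercubic symmetry of the Wilson action)] -/
@[simp] theorem plaquettePerm_apply (σ : Equiv.Perm (Fin d)) (p : ZdPlaquette d) :
    plaquettePerm σ p = plaquettePermFun σ p := rfl

/-- The edges of the permuted plaquette are the permuted edges. [cite: SeilerLNP1982, Ch. 2 (hypercubic symmetry of the Wilson action)] -/
theorem plaquetteEdges_plaquettePerm (σ : Equiv.Perm (Fin d)) (p : ZdPlaquette d) :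
    plaquetteEdges (plaquettePerm σ p) = (plaquetteEdges p).map (edgePerm σ).toEmbedding := by
  obtain ⟨x, ⟨⟨i, j⟩, hij⟩⟩ := p
  have hne : σ i ≠ σ j := σ.injective.ne (ne_of_lt hij)
  have hmap : (plaquetteEdges ⟨x, ⟨(i, j), hij⟩⟩).map (edgePerm σ).toEmbedding =
      {(sitePerm σ x, σ i), (sitePerm σ x + Pi.single (σ i) 1, σ j),
        (sitePerm σ x + Pi.single (σ j) 1, σ i), (sitePerm σ x, σ j)} := by
    simp only [plaquetteEdges, Finset.map_insert, Finset.map_singleton, Equiv.toEmbedding_apply,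
      edgePerm_apply, sitePerm_add, sitePerm_single]
  rw [hmap, plaquettePerm_apply]
  simp only [plaquettePermFun]
  rcases lt_or_gt_of_ne hne with h | h
  · rw [orderedPair_of_lt h]
    simp only [plaquetteEdges]
  · rw [orderedPair_of_gt h]
    ext e
    simp only [plaquetteEdges, Finset.mem_insert, Finset.mem_singleton]
    tauto

/-- The plaquettes touching a permuted edge set are the permuted plaquettes. [cite: SeilerLNP1982, Ch. 2 (hypercubic symmetry of the Wilson action)] -/
theorem plaquettesTouching_map_edgePerm (σ : Equiv.Perm (Fin d)) (Λ : Finset (ZdEdge d)) :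
    plaquettesTouching (Λ.map (edgePerm σ).toEmbedding) =
      (plaquettesTouching Λ).map (plaquettePerm σ).toEmbedding := by
  ext p
  rw [Finset.mem_map_equiv, mem_plaquettesTouching_iff, mem_plaquettesTouching_iff]
  conv_lhs => rw [← (plaquettePerm σ).apply_symm_apply p, plaquetteEdges_plaquettePerm,
    ← Finset.map_inter, Finset.map_nonempty]

variable [Group G]

/-- Reversing the order of the two directions inverts the plaquette holonomy:
`U_{x; ji} = (U_{x; ij})⁻¹` (the reversed boundary carries the inverse parallel transporter). [cite: Wilson1974] -/
theorem plaquetteHolonomyZd_swap (U : LGConfig d G) (x : Site d) (i j : Fin d) :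
    plaquetteHolonomyZd U x j i = (plaquetteHolonomyZd U x i j)⁻¹ := by
  simp only [plaquetteHolonomyZd, mul_inv_rev, inv_inv, mul_assoc]

/-- The plaquette holonomy of the permuted configuration around the permuted plaquette (same
order of directions) is the original one. [cite: SeilerLNP1982, Ch. 2 (hypercubic symmetry of the Wilson action)] -/
theorem plaquetteHolonomyZd_relabel_edgePerm [MeasurableSpace G] (σ : Equiv.Perm (Fin d))
    (U : LGConfig d G) (x : Site d) (i j : Fin d) :
    plaquetteHolonomyZd (relabelConfig (edgePerm σ) U) (sitePerm σ x) (σ i) (σ j) =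
      plaquetteHolonomyZd U x i j := by
  simp only [plaquetteHolonomyZd, relabelConfig_apply, edgePerm_symm_apply, ← sitePerm_single σ,
    ← sitePerm_add, ← sitePerm_symm, Equiv.symm_apply_apply]

variable (ρ : G →* Matrix (Fin N) (Fin N) ℂ) [TopologicalSpace G] [IsTopologicalGroup G]
  [CompactSpace G]

/-- **The boundary Wilson action is invariant under coordinate permutations**:
`S_{σΛ}(U ∘ (edgePerm σ)⁻¹) = S_Λ(U)` for a continuous representation `ρ` of the compact group `G`
(a plaquette whose directions get re-ordered contributes `Re tr ρ(U_p⁻¹) = Re tr ρ(U_p)`,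
`CompactGroup.re_trace_map_inv`) (Seiler LNP 159 Ch. 2, hypercubic symmetry of the Wilson action). [cite: SeilerLNP1982, Ch. 2 (symmetries of the Wilson action)] -/
theorem wilsonBoundaryAction_relabel_edgePerm [MeasurableSpace G] (hρ : Continuous ρ)
    (σ : Equiv.Perm (Fin d)) (Λ : Finset (ZdEdge d)) (U : LGConfig d G) :
    wilsonBoundaryAction ρ (Λ.map (edgePerm σ).toEmbedding) (relabelConfig (edgePerm σ) U) =
      wilsonBoundaryAction ρ Λ U := by
  unfold wilsonBoundaryAction
  rw [plaquettesTouching_map_edgePerm, Finset.sum_map]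
  refine Finset.sum_congr rfl fun p _ => ?_
  obtain ⟨x, ⟨⟨i, j⟩, hij⟩⟩ := p
  have hne : σ i ≠ σ j := σ.injective.ne (ne_of_lt hij)
  simp only [Equiv.toEmbedding_apply, plaquettePerm_apply, plaquettePermFun, plaquetteObs]
  rcases lt_or_gt_of_ne hne with h | h
  · rw [orderedPair_of_lt h]
    simp only [plaquetteHolonomyZd_relabel_edgePerm]
  · rw [orderedPair_of_gt h]
    simp only
    rw [plaquetteHolonomyZd_relabel_edgePerm, plaquetteHolonomyZd_swap,
      Literature.RepresentationTheory.CompactGroups.CompactGroup.re_trace_map_inv ρ hρ]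

variable [MeasurableSpace G] [BorelSpace G] [SecondCountableTopology G]

/-- **Covariance of the lattice Yang–Mills kernels under coordinate permutations**
(Georgii 2011, §5.1 (5.8); Seiler LNP 159 Ch. 2). [cite: Georgii2011, §5.1 (5.8)] -/
theorem ymSpecification_map_relabel_edgePerm (hρ : Continuous ρ) (β : ℝ) (σ : Equiv.Perm (Fin d))
    (Λ : Finset (ZdEdge d)) (η : LGConfig d G) :
    (ymSpecification ρ β Λ η).map (relabelConfig (edgePerm σ)) =
      ymSpecification ρ β (Λ.map (edgePerm σ).toEmbedding) (relabelConfig (edgePerm σ) η) :=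
  ymSpecification_map_relabelConfig ρ hρ β (edgePerm σ)
    (fun Λ U => wilsonBoundaryAction_relabel_edgePerm ρ hρ σ Λ U) Λ η

/-- **Coordinate permutations act on the lattice Yang–Mills DLR states**
(Georgii 2011, §5.1 Remark (5.10)). [cite: Georgii2011, §5.1 Remark (5.10)] -/
theorem map_relabel_edgePerm_mem_ymGibbsMeasures (hρ : Continuous ρ) (β : ℝ)
    (σ : Equiv.Perm (Fin d)) {μ : Measure (LGConfig d G)} (hμ : μ ∈ ymGibbsMeasures ρ β) :
    μ.map (relabelConfig (edgePerm σ)) ∈ ymGibbsMeasures ρ β :=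
  map_relabelConfig_mem_ymGibbsMeasures ρ hρ β (edgePerm σ)
    (fun Λ U => wilsonBoundaryAction_relabel_edgePerm ρ hρ σ Λ U) hμ

end Permutation

end Literature.MathematicalPhysics.QuantumLattice

end
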